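import Literature.Probability.RandomPlanarGeometry.SAWTriangularPolygonInsertionStep
import Literature.Probability.RandomPlanarGeometry.SAWTriangularLoopRatioLimit
import Literature.Probability.RandomPlanarGeometry.SAWTriangularPolygonPairs
import HarnessLib

/-!
# Walk–polygon and polygon–polygon insertion inequalities on `𝕋` («TRI-SAP-RATIO-RATE» / «TRI-ENDPOINT-RATIO-RATE», G2ʷ — part 4 of 4)

Topic `Literature/Probability/RandomPlanarGeometry` (lane «pcv-sawmu», routes R82 «TRI-SAP-RATIO-RATE» and R83
«TRI-ENDPOINT-RATIO-RATE»). Source: N. Madras, G. Slade, *The Self-Avoiding Walk* (1993), §3.2 (concatenation of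
polygons, Theorem 3.2.3 `p_{n+m} ≥ p_n p_m / (d-1)` on `ℤ^d`) and its use as the insertion hypothesis of the
fixed-endpoint / polygon ratio theorem, Theorem 7.4.5 (c) p. 254. Printed for `ℤ^d`; this file gives the `𝕋`
versions with polynomial slack and a stem of `4` edges (the lane's relaxed doors, planner a-idea-1 g13 R83 faces
`TriEndpointIns`, `TriSAPInsPoly` — bodies verbatim below):

* frame `b`: `highSLx`, `params`, `decode`, **`card_highSLx_mul_loopSL_le`**:
  `#S⁺_n(y) · #loopSL(m-1) ≤ 4 n m · #S_{n+m+4}(y)`;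
* frames: `Frm` (involutive automorphisms of `𝕋` fixing `0`: `frmId`, `frmNeg`, `frmSwap`, `frmNegSwap`), transport
  `Frm.map_mem_triSL(x)`, `Frm.card_high_mul_loopSL_le`, box exit `mem_high_of_long` (via a-p1's `exists_height_gt`),
  **`card_triSLx_mul_loopSL_le`**: `#S_n(y) · #loopSL(m-1) ≤ 16 n m · #S_{n+m+4}(y)` for `n ≥ (6 rad y + 1)²`, `m ≥ 3`;
* faces: `triLoopCount_eq_card_loopSL`, **`triEndpointIns y : ∃ Z k n₁, ∀ n m, n₁ ≤ n → 3 ≤ m →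
  #(triSLx n y) * triLoopCount m ≤ Z * (n + m + k) ^ 6 * #(triSLx (n + m + k) y)`** (`Z = 16`, `k = 4`),
  `triEndpointIns_uniform`, **`triSAPInsPoly : ∃ Z k n₁, ∀ n m, n₁ ≤ n → 3 ≤ m →
  triLoopCount n * triLoopCount m ≤ Z * (n + m + k) ^ 6 * triLoopCount (n + m + k)`**.
-/

noncomputable section

open Finset Literature.Probability.LatticeModels Literature.Probability.Percolation SimpleGraph
open scoped BigOperators

namespace Literature.Probability.RandomPlanarGeometry.SAW

namespace PolygonInsertion

variable {n m : ℕ} {ω lam : List (Site 2)} {y : Site 2}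

/-! ### Counting in frame `b` -/

open Classical in
/-- The walks of `S_n(𝕋)` ending at `y` with a vertex strictly above the rows of both endpoints (frame `b`: rows are
the second coordinate). [cite: MadrasSlade1993, §3.2] -/
def highSLx (n : ℕ) (y : Site 2) : Finset (List (Site 2)) :=
  (triSLx n y).filter fun ω => ∃ i ≤ n, 0 < (ω.getD i 0) 1 ∧ y 1 < (ω.getD i 0) 1

/-- The decoding parameters: splice position, connector bit, root position, direction bit. [cite: MadrasSlade1993, §3.2 (concatenation of polygons; bookkeeping)] -/
def params (n m : ℕ) : Finset (ℕ × Bool × ℕ × Bool) :=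
  Finset.range n ×ˢ (Finset.univ ×ˢ (Finset.range m ×ˢ Finset.univ))

/-- Bookkeeping (`card_params`). [cite: MadrasSlade1993, §3.2 (concatenation of polygons; bookkeeping)] -/
theorem card_params (n m : ℕ) : #(params n m) = 4 * n * m := by
  simp only [params, Finset.card_product, Finset.card_range, Finset.card_univ, Fintype.card_bool]; ring

/-- The decoder `(ω', parameters) ↦ (ω, λ)`. [cite: MadrasSlade1993, §3.2 (concatenation of polygons; bookkeeping)] -/
def decode (m : ℕ) (z : List (Site 2) × (ℕ × Bool × ℕ × Bool)) : List (Site 2) × List (Site 2) :=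
  (z.1.take (z.2.1 + 1) ++ z.1.drop (z.2.1 + 1 + (m + 4)),
    polyDecode (pathOf z.2.2.1 m ((z.1.drop (z.2.1 + 1)).take (m + 4))) z.2.2.2.1 z.2.2.2.2)

/-- **Frame-`b` count.** `#S⁺_n(y) · t_m ≤ 4 n m · #S_{n+m+4}(y)`: the insertion is undone by the decoder given
`4nm` parameter values. [cite: MadrasSlade1993, §3.2 (concatenation of polygons, proof of Theorem 3.2.3)] -/
theorem card_highSLx_mul_loopSL_le (n : ℕ) (hm : 3 ≤ m) (y : Site 2) :
    #(highSLx n y) * #(loopSL (m - 1)) ≤ 4 * n * m * #(triSLx (n + m + 4) y) := by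
  classical
  have hsub : highSLx n y ×ˢ loopSL (m - 1) ⊆
      (triSLx (n + m + 4) y ×ˢ params n m).image (decode m) := by
    rintro ⟨ω, lam⟩ h
    simp only [Finset.mem_product] at h
    obtain ⟨hω, hlam⟩ := h
    obtain ⟨hωx, i, hi, hi0, hiy⟩ := Finset.mem_filter.1 hω
    obtain ⟨hωS, hωy⟩ := mem_triSLx.1 hωx
    have hl := length_of_mem_triSL hωS
    obtain ⟨j, hT⟩ := exists_isTopLeft ω n
    have hjrow := hT.row_le i hi
    have h0 : 0 < j := by
      rcases Nat.eq_zero_or_pos j with rfl | h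
      · rw [getD_zero_of_mem_triSL hωS] at hjrow
        simp only [Pi.zero_apply] at hjrow; omega
      · exact h
    have hjn : j < n := by
      rcases lt_or_eq_of_le hT.le with h | rfl
      · exact h
      · rw [hωy] at hjrow; omega
    obtain ⟨s, c, r₀, d₀, Λ, hs, hr₀, hΛ, hmem, hdec⟩ := exists_insertion hωS hT h0 hjn hlam hm
    refine Finset.mem_image.2 ⟨(splice s Λ ω, (s, c, r₀, d₀)), ?_, ?_⟩
    · rw [Finset.mem_product]
      refine ⟨mem_triSLx.2 ⟨by rw [Nat.add_assoc]; exact hmem, ?_⟩, by simp [params, hs, hr₀]⟩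
      rw [Nat.add_assoc, ← hΛ, getD_splice_last hωS (by omega), hωy]
    · have hs' : s + 1 ≤ ω.length := by omega
      simp only [decode]
      rw [Prod.mk.injEq, ← hΛ, take_append_drop_splice hs', take_drop_splice hs']
      exact ⟨rfl, hdec⟩
  calc #(highSLx n y) * #(loopSL (m - 1)) = #(highSLx n y ×ˢ loopSL (m - 1)) := (Finset.card_product _ _).symm
    _ ≤ #((triSLx (n + m + 4) y ×ˢ params n m).image (decode m)) := Finset.card_le_card hsub
    _ ≤ #(triSLx (n + m + 4) y ×ˢ params n m) := Finset.card_image_le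
    _ = 4 * n * m * #(triSLx (n + m + 4) y) := by rw [Finset.card_product, card_params]; ring

/-! ### The four frames -/

/-- A frame: an involutive automorphism of `𝕋` fixing `0`; its rows are the second coordinate after the map.
[cite: MadrasSlade1993, §3.2] -/
structure Frm where
  /-- the automorphism -/
  σ : Site 2 → Site 2
  invol : ∀ x, σ (σ x) = x
  zero : σ 0 = 0
  adj : ∀ x y, triGraph.Adj x y → triGraph.Adj (σ x) (σ y)

namespace Frm

variable (F : Frm)

/-- Bookkeeping (`injective`). [cite: MadrasSlade1993, §3.2 (concatenation of polygons; bookkeeping)] -/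
theorem injective : Function.Injective F.σ := fun a b h => by rw [← F.invol a, h, F.invol]

/-- Bookkeeping (`adj_iff`). [cite: MadrasSlade1993, §3.2 (concatenation of polygons; bookkeeping)] -/
theorem adj_iff (x y : Site 2) : triGraph.Adj (F.σ x) (F.σ y) ↔ triGraph.Adj x y :=
  ⟨fun h => by simpa only [F.invol] using F.adj _ _ h, F.adj x y⟩

/-- Bookkeeping (`getD_map`). [cite: MadrasSlade1993, §3.2 (concatenation of polygons; bookkeeping)] -/
theorem getD_map (ω : List (Site 2)) (i : ℕ) : (ω.map F.σ).getD i 0 = F.σ (ω.getD i 0) := by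
  simp only [List.getD_eq_getElem?_getD, List.getElem?_map]
  cases ω[i]? <;> simp [F.zero]

/-- Frames transport walks. [cite: MadrasSlade1993, §3.2] -/
theorem map_mem_triSL {n : ℕ} {ω : List (Site 2)} (hω : ω ∈ triSL n) : ω.map F.σ ∈ triSL n := by
  refine mem_triSL_of (by rw [List.length_map, length_of_mem_triSL hω]) ?_ (fun i hi => ?_)
    ((nodup_of_mem_triSL hω).map F.injective)
  · rw [F.getD_map, getD_zero_of_mem_triSL hω, F.zero]
  · rw [F.getD_map, F.getD_map, F.adj_iff]; exact adj_getD_of_mem_triSL hω hi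

/-- Frames transport fixed-endpoint walks. [cite: MadrasSlade1993, §3.2] -/
theorem map_mem_triSLx {n : ℕ} {ω : List (Site 2)} {y : Site 2} (hω : ω ∈ triSLx n y) :
    ω.map F.σ ∈ triSLx n (F.σ y) := by
  obtain ⟨h1, h2⟩ := mem_triSLx.1 hω
  exact mem_triSLx.2 ⟨F.map_mem_triSL h1, by rw [F.getD_map, h2]⟩

/-- Fixed-endpoint counts are frame invariant (one inequality). [cite: MadrasSlade1993, §3.2] -/
theorem card_triSLx_map_le (n : ℕ) (y : Site 2) : #(triSLx n (F.σ y)) ≤ #(triSLx n y) := by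
  classical
  refine Finset.card_le_card_of_injOn (List.map F.σ) (fun ω hω => ?_)
    fun a _ b _ h => List.map_injective_iff.2 F.injective h
  have h := F.map_mem_triSLx (Finset.mem_coe.1 hω)
  rw [F.invol] at h
  exact h

open Classical in
/-- The walks that are high in the frame. [cite: MadrasSlade1993, §3.2] -/
def high (n : ℕ) (y : Site 2) : Finset (List (Site 2)) :=
  (triSLx n y).filter fun ω => ∃ i ≤ n, 0 < (F.σ (ω.getD i 0)) 1 ∧ (F.σ y) 1 < (F.σ (ω.getD i 0)) 1

/-- Bookkeeping (`card_high_le`). [cite: MadrasSlade1993, §3.2 (concatenation of polygons; bookkeeping)] -/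
theorem card_high_le (n : ℕ) (y : Site 2) : #(F.high n y) ≤ #(highSLx n (F.σ y)) := by
  classical
  refine Finset.card_le_card_of_injOn (List.map F.σ) (fun ω hω => ?_)
    fun a _ b _ h => List.map_injective_iff.2 F.injective h
  obtain ⟨hω, i, hi, h1, h2⟩ := Finset.mem_filter.1 (Finset.mem_coe.1 hω)
  exact Finset.mem_coe.2 (Finset.mem_filter.2 ⟨F.map_mem_triSLx hω, i, hi, by rw [F.getD_map]; exact ⟨h1, h2⟩⟩)

/-- **Count in an arbitrary frame.** [cite: MadrasSlade1993, §3.2 (concatenation of polygons)] -/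
theorem card_high_mul_loopSL_le (n : ℕ) {m : ℕ} (hm : 3 ≤ m) (y : Site 2) :
    #(F.high n y) * #(loopSL (m - 1)) ≤ 4 * n * m * #(triSLx (n + m + 4) y) :=
  calc #(F.high n y) * #(loopSL (m - 1)) ≤ #(highSLx n (F.σ y)) * #(loopSL (m - 1)) :=
        Nat.mul_le_mul_right _ (F.card_high_le n y)
    _ ≤ 4 * n * m * #(triSLx (n + m + 4) (F.σ y)) := card_highSLx_mul_loopSL_le n hm _
    _ ≤ 4 * n * m * #(triSLx (n + m + 4) y) := Nat.mul_le_mul_left _ (F.card_triSLx_map_le _ _)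

end Frm

/-- The identity frame (rows `b`). [cite: MadrasSlade1993, §3.2] -/
def frmId : Frm := ⟨id, fun _ => rfl, rfl, fun _ _ h => h⟩

/-- The central-symmetry frame (rows `-b`). [cite: MadrasSlade1993, §3.2] -/
def frmNeg : Frm where
  σ x := -x
  invol x := neg_neg x
  zero := neg_zero
  adj x y h := by
    rw [triGraph_adj_iff_coord] at h ⊢; simp only [Pi.neg_apply]; omega

/-- The coordinate-swap frame (rows `a`). [cite: MadrasSlade1993, §3.2] -/
def frmSwap : Frm where
  σ x := ![x 1, x 0]
  invol x := by rw [site_two_eq_iff]; simp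
  zero := by rw [site_two_eq_iff]; simp
  adj x y h := by
    rw [triGraph_adj_iff_coord] at h ⊢
    simp only [Matrix.cons_val_zero, Matrix.cons_val_one, Matrix.cons_val_fin_one]
    omega

/-- The swapped central-symmetry frame (rows `-a`). [cite: MadrasSlade1993, §3.2] -/
def frmNegSwap : Frm where
  σ x := ![-x 1, -x 0]
  invol x := by rw [site_two_eq_iff]; simp
  zero := by rw [site_two_eq_iff]; simp
  adj x y h := by
    rw [triGraph_adj_iff_coord] at h ⊢
    simp only [Matrix.cons_val_zero, Matrix.cons_val_one, Matrix.cons_val_fin_one]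
    omega

/-- The box radius of the endpoint. [cite: MadrasSlade1993, §3.2 (concatenation of polygons; bookkeeping)] -/
def rad (y : Site 2) : ℕ := max (y 0).natAbs (y 1).natAbs

/-- **Every long walk is high in one of the four frames** (it leaves the box of its endpoint).
[cite: MadrasSlade1993, Lemma 7.3.3 (proof), §3.2] -/
theorem mem_high_of_long (hω : ω ∈ triSLx n y) (hn : (2 * (3 * rad y) + 1) ^ 2 < n + 1) :
    ω ∈ frmId.high n y ∨ ω ∈ frmNeg.high n y ∨ ω ∈ frmSwap.high n y ∨ ω ∈ frmNegSwap.high n y := by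
  classical
  have hωS := (mem_triSLx.1 hω).1
  obtain ⟨i, hi, hfar⟩ := exists_height_gt (A := 3 * rad y) hωS hn
  have hA0 : (y 0).natAbs ≤ rad y := le_max_left _ _
  have hA1 : (y 1).natAbs ≤ rad y := le_max_right _ _
  have e0 : ((y 0).natAbs : ℤ) = |y 0| := Int.natCast_natAbs _
  have e1 : ((y 1).natAbs : ℤ) = |y 1| := Int.natCast_natAbs _
  simp only [gH1, gH2, AddMonoidHom.coe_mk, ZeroHom.coe_mk, Nat.cast_mul, Nat.cast_ofNat] at hfar
  set a := (ω.getD i 0) 0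
  set b := (ω.getD i 0) 1
  have hab : (rad y : ℤ) < |a| ∨ (rad y : ℤ) < |b| := by
    rcases hfar with h | h
    · by_contra hc; push Not at hc
      have := abs_add_le (2 * a) b; rw [abs_mul] at this; norm_num at this; omega
    · by_contra hc; push Not at hc
      have := abs_add_le a (2 * b); rw [abs_mul] at this; norm_num at this; omega
  have hy0 : |y 0| ≤ rad y := by rw [← e0]; exact_mod_cast hA0
  have hy1 : |y 1| ≤ rad y := by rw [← e1]; exact_mod_cast hA1
  have habs0 := abs_le.1 hy0
  have habs1 := abs_le.1 hy1
  simp only [Frm.high, frmId, frmNeg, frmSwap, frmNegSwap, Finset.mem_filter, id, Pi.neg_apply,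
    Matrix.cons_val_one, Matrix.cons_val_fin_one]
  rcases hab with h | h
  · rcases lt_abs.1 h with h | h
    · exact Or.inr (Or.inr (Or.inl ⟨hω, i, hi, by omega, by omega⟩))
    · exact Or.inr (Or.inr (Or.inr ⟨hω, i, hi, by omega, by omega⟩))
  · rcases lt_abs.1 h with h | h
    · exact Or.inl ⟨hω, i, hi, by omega, by omega⟩
    · exact Or.inr (Or.inl ⟨hω, i, hi, by omega, by omega⟩)

/-- **All-frames count.** For `n ≥ (6·rad y + 1)²` and `m ≥ 3`:
`#S_n(y) · #loopSL(m-1) ≤ 16 n m · #S_{n+m+4}(y)`. [cite: MadrasSlade1993, §3.2 (concatenation of polygons)] -/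
theorem card_triSLx_mul_loopSL_le (hn : (2 * (3 * rad y) + 1) ^ 2 ≤ n) (hm : 3 ≤ m) :
    #(triSLx n y) * #(loopSL (m - 1)) ≤ 16 * n * m * #(triSLx (n + m + 4) y) := by
  classical
  have hcov : triSLx n y ⊆ frmId.high n y ∪ frmNeg.high n y ∪ frmSwap.high n y ∪ frmNegSwap.high n y := by
    intro ω hω
    rcases mem_high_of_long hω (by omega) with h | h | h | h <;> simp [h]
  have h4 := fun F : Frm => F.card_high_mul_loopSL_le n hm y
  calc #(triSLx n y) * #(loopSL (m - 1))
      ≤ #(frmId.high n y ∪ frmNeg.high n y ∪ frmSwap.high n y ∪ frmNegSwap.high n y) * #(loopSL (m - 1)) :=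
        Nat.mul_le_mul_right _ (Finset.card_le_card hcov)
    _ ≤ (#(frmId.high n y) + #(frmNeg.high n y) + #(frmSwap.high n y) + #(frmNegSwap.high n y)) *
          #(loopSL (m - 1)) := by
        gcongr
        exact (Finset.card_union_le _ _).trans (Nat.add_le_add_right ((Finset.card_union_le _ _).trans
          (Nat.add_le_add_right (Finset.card_union_le _ _) _)) _)
    _ ≤ 4 * (4 * n * m * #(triSLx (n + m + 4) y)) := by
        have := h4 frmId; have := h4 frmNeg; have := h4 frmSwap; have := h4 frmNegSwap
        nlinarith
    _ = 16 * n * m * #(triSLx (n + m + 4) y) := by ring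

/-! ### The faces -/

/-- `t_m = #loopSL (m - 1)`: the lane's rooted oriented polygon count in the list model.
[cite: MadrasSlade1993, §3.2 (3.2.1)] -/
theorem triLoopCount_eq_card_loopSL (m : ℕ) : triLoopCount m = #(loopSL (m - 1)) := by
  rw [card_loopSL]; rfl

/-- **G2ʷ, walk–polygon insertion with fixed endpoint (a-p1's face `TriEndpointIns y`, uniform stem `k = 4`).**
For every endpoint `y` there are `Z, k, n₁` with `#S_n(y) · t_m ≤ Z (n+m+k)^6 · #S_{n+m+k}(y)` for `n ≥ n₁`, `m ≥ 3`
(here `Z = 16`, `k = 4`, `n₁ = (6·rad y + 1)²`). [cite: MadrasSlade1993, §3.2 (concatenation of polygons, proof of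
Theorem 3.2.3); Theorem 7.4.5 (c) p. 254 (use)] -/
theorem triEndpointIns (y : Site 2) : ∃ Z k n₁ : ℕ, ∀ n m : ℕ, n₁ ≤ n → 3 ≤ m →
    #(triSLx n y) * triLoopCount m ≤ Z * (n + m + k) ^ 6 * #(triSLx (n + m + k) y) := by
  refine ⟨16, 4, (2 * (3 * rad y) + 1) ^ 2, fun n m hn hm => ?_⟩
  rw [triLoopCount_eq_card_loopSL]
  refine (card_triSLx_mul_loopSL_le hn hm).trans (Nat.mul_le_mul_right _ ?_)
  have h1 : n ≤ n + m + 4 := by omega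
  have h2 : m ≤ n + m + 4 := by omega
  calc 16 * n * m ≤ 16 * (n + m + 4) * (n + m + 4) := by gcongr
    _ = 16 * (n + m + 4) ^ 2 := by ring
    _ ≤ 16 * (n + m + 4) ^ 6 := Nat.mul_le_mul_left _ (Nat.pow_le_pow_right (by omega) (by norm_num))

/-- The insertion with UNIFORM stem `k = 4` and constant `16`, for all endpoints at once (the form the polygon
corollary sums over the six neighbours of `0`). [cite: MadrasSlade1993, §3.2] -/
theorem triEndpointIns_uniform (y : Site 2) : ∃ n₁ : ℕ, ∀ n m : ℕ, n₁ ≤ n → 3 ≤ m →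
    #(triSLx n y) * triLoopCount m ≤ 16 * n * m * #(triSLx (n + m + 4) y) :=
  ⟨(2 * (3 * rad y) + 1) ^ 2, fun n m hn hm => by
    rw [triLoopCount_eq_card_loopSL]; exact card_triSLx_mul_loopSL_le hn hm⟩


/-- **G2, polygon–polygon insertion (a-idea-1's face `TriSAPInsPoly`, uniform stem `k = 4`, `Z = 16`).**
`t_n · t_m ≤ Z (n+m+k)^6 · t_{n+m+k}` for `n ≥ n₁`, `m ≥ 3`: the fixed-endpoint insertion summed over the six
neighbours of `0`. [cite: MadrasSlade1993, §3.2 (concatenation of polygons, Theorem 3.2.3)] -/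
theorem triSAPInsPoly : ∃ Z k n₁ : ℕ, ∀ n m : ℕ, n₁ ≤ n → 3 ≤ m →
    triLoopCount n * triLoopCount m ≤ Z * (n + m + k) ^ 6 * triLoopCount (n + m + k) := by
  classical
  choose n₁ hn₁ using fun x : Site 2 => triEndpointIns_uniform x
  refine ⟨16, 4, (triGraph.neighborFinset (0 : Site 2)).sup n₁ + 1, fun n m hn hm => ?_⟩
  obtain ⟨n', rfl⟩ : ∃ n', n = n' + 1 := ⟨n - 1, by omega⟩
  rw [triLoopCount_eq_card_loopSL (n' + 1), triLoopCount_eq_card_loopSL (n' + 1 + m + 4), Nat.add_sub_cancel,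
    show n' + 1 + m + 4 - 1 = n' + m + 4 by omega, card_loopSL_eq_sum, card_loopSL_eq_sum, Finset.sum_mul,
    Finset.mul_sum]
  refine Finset.sum_le_sum fun x hx => ?_
  refine (hn₁ x n' m (le_trans (Finset.le_sup hx) (by omega)) hm).trans (Nat.mul_le_mul_right _ ?_)
  calc 16 * n' * m ≤ 16 * (n' + 1 + m + 4) * (n' + 1 + m + 4) := by gcongr <;> omega
    _ = 16 * (n' + 1 + m + 4) ^ 2 := by ring
    _ ≤ 16 * (n' + 1 + m + 4) ^ 6 := Nat.mul_le_mul_left _ (Nat.pow_le_pow_right (by omega) (by norm_num))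

end PolygonInsertion

end Literature.Probability.RandomPlanarGeometry.SAW
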